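/-
Copyright (c) 2026 the pub-hodgecm-mathlib formalisation cell (harness21).  Prover seat hodgecm-mathlib-K2E3-p04 (g3), Track B ∕ K2-LIT
(build stream 29), h413 = `stmt-HodgeConjecture-24833`, line `K2_E3_EllipticInputs`, unit U4 «Keys» — road I («Keys' own road»: the rank-one intertwining
integral), brick I-3ℓ (b-3) «MACDONALD'S FORMULA AND THE JUNCTION AT EVERY RAMIFIED PLACE, WILD RAMIFICATION INCLUDED».  2026-09-04.
-/
import Summits.HodgeConjecture.HodgeConjecture.Theorems.K2E3SphericalReducibilityJunction      -- ★ p856463 (this base, g2): the junction at `v ∤ 2`; brings ★ p856339 Macdonald, ★ Factorization, ★ I-2a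
import Summits.HodgeConjecture.HodgeConjecture.Theorems.K2E3SphericalCFunctionOrganCurrency    -- ★ p856667 (this base, g2): organ currency; brings ★ p856288 UnramifiedHypotheses
import Summits.HodgeConjecture.HodgeConjecture.Theorems.K2E3HeightBallIndexWild               -- ★ p856896 (this base, g3): `μ{‖u₀₂‖ ≤ ‖ϖ‖⁻¹} = q_F·μ{‖u₀₂‖ ≤ 1}` at EVERY ramified place
import HarnessLib

/-!
# h413 ∕ Track B «K2-LIT», unit U4 «Keys», road I brick I-3ℓ (b-3): MACDONALD'S FORMULA `c_w(χ) = μ(B₁)·(1 − z∕q_F)∕(1 − z)` FOR THE `c`-FUNCTION OF `U(Φ₃)(L⁺_v)` AND THE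
# REDUCIBILITY JUNCTION AT EVERY RAMIFIED NON-SPLIT PLACE OF `L⁺` — THE HYPOTHESIS `|2|_w = 1` OF ★ p856339 §4–§5 ∕ ★ p856463 (ramified) REMOVED   [Rogawski1990 §4.5; Casselman1995 §6.4; Keys1984 §4, §7]

Cell `pub/hodgecm-mathlib`, crux H413 = `stmt-HodgeConjecture-24833` (lane `--supports … --as helper`), route HCCMUnconditional; dealer K2E3-plan (g2) («NEXT after I-3k = I-3ℓ»; this
seat: I-3ℓ := road I (b) «wild ramified places», file (b-3), the assembly).  THEOREMS ONLY (0 def ∕ 0 instance ∕ 0 notation ∕ 0 sorry); ★-only imports.  U4-f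
`sig_K2E3KeysThmTwoContracting` quantifies over EVERY non-split place; the ramified places with `v ∣ 2` (wild: different exponent `d ≥ 2`) were the last place type where road I's
closed form was missing.  ★ p856896 supplies the index `[B_q : B₁] = q_F` there (fibre product ★ p856853 + the ramified quadratic datum ★ `WildQuadraticDatumTrace`), and this file
threads it through the ★ chain exactly as ★ p856802 did for the dyadic INERT places:

* §1 **`integral_cellFun_eq_macdonald_ramified`** — `∫_N f(w₀u) dμ = μ(B₁)·(1 − z∕q_F)(1 − z)⁻¹·f(1)` for a `K_v`-fixed `f ∈ i_G(χ₁, χ₂)`, `χ₁` unramified with `|χ₁| = ‖·‖^s`, `s > 0`,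
  `z = χ₁(ϖ)`, at EVERY ramified non-split place.
* §2 **`exists_intertwiningIntegral_sphericalVector_eq_macdonald_ramified_smul`** — `J(w,χ) f_K = (μ(B₁)·(1 − z∕q_F)(1 − z)⁻¹·f_K(1)) • f'_K` (docked on ★ I-2a).
* §3 **`exists_intertwiningIntegral_sphericalVector_eq_macdonald_ramified_smul_of_trivial`** — the same in the organ's currency («`χ` trivial on `T ∩ K_v`» + «contracting»; NEW also
  at tame places: ★ p856667 typed the inert case only).
* §4 **`reducible_iff_forall_counterIntertwiner_eval_eq_zero_ramified`** — THE JUNCTION at every ramified place: for regular unramified contracting `χ`,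
  `i_G(χ)` reducible ⟺ `(B f'_K)(1) = 0` for every `G`-map `B : i(wχ) → i(χ)`.
Statements = those of ★ p856339 §4–§5 ∕ ★ p856463 (ramified) with the binder `(h2w : Valued.v (2 : w.1.adicCompletion L) = 1)` DELETED and nothing else changed; proofs = theirs
with the index input re-routed through ★ p856896.  ROAD I's closed form and junction now hold at EVERY non-split place of `L⁺` (inert: ★ p856802; ramified: here); what remains
for U4-f on the unramified line is the junction NUMBER `(B f'_K)(1)` (road II, the Iwahori line — K2E3-p05), and off it the ramified-`χ₁` half (Keys §4–§6, acq-15210).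

HONEST LABEL.  HC_CM is proved only modulo the 7 printed citations (2 remaining named inputs: hLiu418 = `stmt-HodgeConjecture-24832`, h413 = `stmt-HodgeConjecture-24833`) until
rung 0 closes; count-neutral (road I helper toward U4-f).

## References
* [Rogawski1990] J. D. Rogawski, *Automorphic Representations of Unitary Groups in Three Variables*, Ann. of Math. Stud. 123 (1990), §4.5 p. 45 (Macdonald's formula), §1.10 p. 9,
  §12.2 p. 173 (reducibility points).
* [Casselman1995] W. Casselman, *Introduction to the theory of admissible representations of `p`-adic reductive groups* (1995), §6.4 pp. 62–64 (the `c`-function), Thm. 6.6.2 p. 66.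
* [Keys1984] D. Keys, *Principal series representations of special unitary groups over local fields*, Compositio Math. 51 (1984), §4, §7 Thm (2).
* [Serre1979] J.-P. Serre, *Local Fields*, GTM 67 (1979), Ch. III §3 Prop. 7, §6 Prop. 13 (the different of a ramified quadratic extension).
* [CartierCorvallis1979] P. Cartier, *Representations of `p`-adic groups: a survey*, Proc. Symp. Pure Math. 33 (1979), §IV.1, §3.4.
-/

set_option autoImplicit false
-- the mandated namespace repeats the single-problem summit's segment (`HodgeConjecture.HodgeConjecture`)
set_option linter.dupNamespace false

noncomputable section

open NumberField IsDedekindDomain MeasureTheory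
open scoped Matrix NNReal ENNReal

open Literature.NumberTheory Literature.NumberTheory.Automorphic Literature.NumberTheory.Automorphic.UnitaryGroup
open Literature.NumberTheory.GaloisRepresentations Literature.NumberTheory.GaloisRepresentations.IsNonarchimedeanLocalField

namespace Summit.HodgeConjecture.HodgeConjecture.Cruxes.H413.K2E3SphericalCFunctionMacdonaldRamifiedWild

variable (L : Type) [Field L] [NumberField L] [IsCMField L] (v : HeightOneSpectrum (𝓞 ↥(maximalRealSubfield L)))

/-! ## §1 Macdonald's formula for `∫_N f(w₀ u) dμ` at every ramified place -/

set_option synthInstance.maxHeartbeats 400000 in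
set_option maxHeartbeats 8000000 in
-- statement∕proof over the `SmoothInd` carrier of ★ `cmPrincipalSeries` (class of ★ `K2E3SphericalCFunctionMacdonald.integral_cellFun_eq_macdonald_ramified`)
/-- **MACDONALD'S FORMULA AT EVERY RAMIFIED PLACE, WILD RAMIFICATION INCLUDED.**  `v` non-split with `e(w|v) ≠ 1` (ANY residue characteristic; `q_F = N𝔭_v = q_w`), `w₀` of matrix `Φ₃`, `μ` a Haar
measure of `N(L⁺_v)`, `ϖ` a uniformiser unit of `E_v`, `χ₂` continuous with `χ₂(−1) = 1`, `χ₁` UNRAMIFIED with `|χ₁(x)| = ‖x‖^s`, `s > 0`, `z = χ₁(ϖ)`, `f` a `K_v`-fixed vector of ★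
`cmPrincipalSeries L 3 v (χ₁, χ₂)`.  Then **`∫_N f(w₀ u) dμ = μ(B₁) · (1 − z∕q_F)(1 − z)⁻¹ · f(1)`** — ★ `integral_cellFun_eq_factoredForm` with `a = ‖ϖ‖ = q_F⁻¹` and the index
`μ(B_{q_F}) = q_F μ(B₁)` of ★ `K2E3HeightBallIndexWild` (the `1 + z` cancels against `1 − z²`); the statement of ★ p856339 §4 with `|2|_w = 1` REMOVED.
[cite: Rogawski1990, §4.5 p. 45] [cite: Casselman1995, §6.4 pp. 62–64] [cite: Keys1984, §4] -/
theorem integral_cellFun_eq_macdonald_ramified (hns : ∀ w : PlacesOver L v, IsCMField.complexConj L • w.1 = w.1) (w : PlacesOver L v)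
    (he : v.asIdeal.ramificationIdx' w.1.asIdeal ≠ 1)
    (χ₁ : (LocalRing L v)ˣ →* ℂˣ) (χ₂ : ↥(normOneUnits (conjLocal L (IsCMField.complexConj L) v)) →* ℂˣ)
    (h₂ : Continuous fun x => ((χ₂ x : ℂˣ) : ℂ)) (hχ₂ : χ₂ ⟨-1, F0P3cStCharTSBigCellFactorisation.neg_one_mem_normOneUnits (conjLocal L (IsCMField.complexConj L) v)⟩ = 1)
    (hunr : ∀ u ∈ (Submonoid.pi Set.univ (fun w : PlacesOver L v => (w.1.adicCompletionIntegers L).toSubring.toSubmonoid)).units, χ₁ u = 1) {s : ℝ} (hs : 0 < s)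
    (hχ₁ : ∀ x : (LocalRing L v)ˣ, ‖((χ₁ x : ℂˣ) : ℂ)‖ = ((unitModulusChar (LocalRing L v) x : ℝ≥0) : ℝ) ^ s)
    (ϖ : (LocalRing L v)ˣ) (hϖ : ∀ w : PlacesOver L v, Valued.v ((ϖ : LocalRing L v) w) = WithZero.exp (-1 : ℤ))
    (w₀ : ↥(unitaryGroupOfForm (conjLocal L (IsCMField.complexConj L) v) (cmLocalForm L 3 v))) (hw₀ : Units.val (w₀ : GL (Fin 3) (LocalRing L v)) = cmLocalForm L 3 v)
    [MeasurableSpace ↥(cmBorelTriple L 3 v).N] [BorelSpace ↥(cmBorelTriple L 3 v).N] (μ : Measure ↥(cmBorelTriple L 3 v).N) [μ.IsHaarMeasure]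
    (f : haveI := locallyCompactSpace_cmBorelU L 3 v
      Representation.SmoothInd (cmBorelTriple L 3 v).P (Representation.twist (((Representation.trivial ℂ ↥(torusU (conjLocal L (IsCMField.complexConj L) v) (cmLocalForm L 3 v)) ℂ).twist
        (cmTorusCharPair L v χ₁ χ₂)).comp (cmBorelTriple L 3 v).proj) (rootDeltaChar (cmBorelTriple L 3 v).P)))
    (hf : haveI := locallyCompactSpace_cmBorelU L 3 v
      f ∈ (Representation.smoothIndRep (cmBorelTriple L 3 v).P _).fixedPoints (cmLocalIntegralLevel L 3 (Matrix.of fun i j : Fin 3 => if i.val + j.val + 1 = 3 then (1 : L) else 0) v)) :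
    ∫ u : ↥(cmBorelTriple L 3 v).N, f.toFun (w₀ * (u : ↥(unitaryGroupOfForm (conjLocal L (IsCMField.complexConj L) v) (cmLocalForm L 3 v)))) ∂μ =
      (μ.real {u : ↥(cmBorelTriple L 3 v).N | (((∏ w' : PlacesOver L v, normAbs (w'.1.adicCompletion L) ((((((u : ↥(unitaryGroupOfForm (conjLocal L (IsCMField.complexConj L) v) (cmLocalForm L 3 v)))) : GL (Fin 3) (LocalRing L v)) : Matrix (Fin 3) (Fin 3) (LocalRing L v)) 0 2) w')) : ℝ≥0) : ℝ) ≤ 1} : ℂ) * ((1 - ((χ₁ ϖ : ℂˣ) : ℂ) / ((Ideal.absNorm v.asIdeal : ℕ) : ℂ)) * (1 - ((χ₁ ϖ : ℂˣ) : ℂ))⁻¹) * f.toFun 1 := by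
  have hw := hns w
  have ha0 : 0 < ((unitModulusChar (LocalRing L v) ϖ : ℝ≥0) : ℝ) := NNReal.coe_pos.2 distribHaarChar_pos
  have ha1 : ((unitModulusChar (LocalRing L v) ϖ : ℝ≥0) : ℝ) < 1 := by exact_mod_cast K2E3SphericalCFunctionShellExpansion.unitModulusChar_uniformizer_lt_one L v hns ϖ hϖ
  have hz : ‖((χ₁ ϖ : ℂˣ) : ℂ)‖ < 1 := by rw [hχ₁ ϖ]; exact Real.rpow_lt_one ha0.le ha1 hs
  have hz1 : (1 : ℂ) - ((χ₁ ϖ : ℂˣ) : ℂ) ≠ 0 := by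
    intro h
    rw [sub_eq_zero] at h
    rw [← h, norm_one] at hz
    exact lt_irrefl _ hz
  have hz1' : (1 : ℂ) + ((χ₁ ϖ : ℂˣ) : ℂ) ≠ 0 := by
    intro h
    rw [add_eq_zero_iff_eq_neg] at h
    rw [← neg_neg ((χ₁ ϖ : ℂˣ) : ℂ), ← h, norm_neg, norm_one] at hz
    exact lt_irrefl _ hz
  have hq0 : ((Ideal.absNorm v.asIdeal : ℕ) : ℂ) ≠ 0 := by exact_mod_cast fun h => v.ne_bot (Ideal.absNorm_eq_zero_iff.1 h)
  have ha : ((unitModulusChar (LocalRing L v) ϖ : ℝ≥0) : ℝ) = (((Ideal.absNorm v.asIdeal : ℕ) : ℝ))⁻¹ := by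
    rw [K2E3HeightBallIndexRamified.unitModulusChar_uniformizer_of_ramified L v w hw he ϖ hϖ, NNReal.coe_inv, NNReal.coe_natCast]
  rw [K2E3SphericalCFunctionFactorization.integral_cellFun_eq_factoredForm L v hns χ₁ χ₂ h₂ hχ₂ hunr hs hχ₁ ϖ hϖ w₀ hw₀ μ f hf,
    K2E3HeightBallIndexWild.measureReal_heightBall_inv_eq_mul_of_ramified L v w hw he ϖ hϖ μ, ha]
  set M₀ : ℝ := μ.real {u : ↥(cmBorelTriple L 3 v).N | (((∏ w' : PlacesOver L v, normAbs (w'.1.adicCompletion L) ((((((u : ↥(unitaryGroupOfForm (conjLocal L (IsCMField.complexConj L) v) (cmLocalForm L 3 v)))) : GL (Fin 3) (LocalRing L v)) : Matrix (Fin 3) (Fin 3) (LocalRing L v)) 0 2) w')) : ℝ≥0) : ℝ) ≤ 1} with hM₀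
  have h1z2 : (1 : ℂ) - ((χ₁ ϖ : ℂˣ) : ℂ) ^ 2 = (1 - ((χ₁ ϖ : ℂˣ) : ℂ)) * (1 + ((χ₁ ϖ : ℂˣ) : ℂ)) := by ring
  rw [h1z2]
  push_cast
  field_simp

/-! ## §2 Harish-Chandra's `c`-function at every ramified place -/

set_option synthInstance.maxHeartbeats 400000 in
set_option maxHeartbeats 8000000 in
-- statement∕proof over two `SmoothInd` carriers of ★ `cmPrincipalSeries` (class of ★ `K2E3SphericalCFunctionMacdonald.exists_intertwiningIntegral_sphericalVector_eq_macdonald_ramified_smul`)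
/-- **HARISH-CHANDRA'S `c`-FUNCTION AT EVERY RAMIFIED PLACE** (docked on ★ I-2a; ★ p856339 §5 without `|2|_w = 1`).  Hypotheses as in §1, plus `χ₁` continuous and `f_K ∈ i_G(χ)^{K_v}`,
`f'_K ∈ i_G(wχ)^{K_v}` with `f'_K(1) = 1`.  Then the intertwining integral `J ≠ 0` of ★ RUNG 3 satisfies **`J f_K = (μ(B₁)·(1 − z∕q_F)(1 − z)⁻¹ · f_K(1)) • f'_K`**; normalised,
**`c_w(χ) = (1 − q_F⁻¹ z)∕(1 − z)`** — the rank-one datum `(q_a, q_{2a}) = (q_F, 1)` of the ramified quasi-split `U(3)`, tame or wild.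
[cite: Rogawski1990, §4.5 p. 45; §12.2 p. 173] [cite: Casselman1995, §6.4 pp. 62–64] [cite: Keys1984, §4, §7 Thm (2)] -/
theorem exists_intertwiningIntegral_sphericalVector_eq_macdonald_ramified_smul (hns : ∀ w : PlacesOver L v, IsCMField.complexConj L • w.1 = w.1) (w : PlacesOver L v)
    (he : v.asIdeal.ramificationIdx' w.1.asIdeal ≠ 1)
    (χ₁ : (LocalRing L v)ˣ →* ℂˣ) (χ₂ : ↥(normOneUnits (conjLocal L (IsCMField.complexConj L) v)) →* ℂˣ)
    (h₁ : Continuous fun x => ((χ₁ x : ℂˣ) : ℂ)) (h₂ : Continuous fun x => ((χ₂ x : ℂˣ) : ℂ)) (hχ₂ : χ₂ ⟨-1, F0P3cStCharTSBigCellFactorisation.neg_one_mem_normOneUnits (conjLocal L (IsCMField.complexConj L) v)⟩ = 1)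
    (hunr : ∀ u ∈ (Submonoid.pi Set.univ (fun w : PlacesOver L v => (w.1.adicCompletionIntegers L).toSubring.toSubmonoid)).units, χ₁ u = 1) {s : ℝ} (hs : 0 < s)
    (hχ₁ : ∀ x : (LocalRing L v)ˣ, ‖((χ₁ x : ℂˣ) : ℂ)‖ = ((unitModulusChar (LocalRing L v) x : ℝ≥0) : ℝ) ^ s)
    (ϖ : (LocalRing L v)ˣ) (hϖ : ∀ w : PlacesOver L v, Valued.v ((ϖ : LocalRing L v) w) = WithZero.exp (-1 : ℤ))
    (w₀ : ↥(unitaryGroupOfForm (conjLocal L (IsCMField.complexConj L) v) (cmLocalForm L 3 v))) (hw₀ : Units.val (w₀ : GL (Fin 3) (LocalRing L v)) = cmLocalForm L 3 v)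
    [MeasurableSpace ↥(cmBorelTriple L 3 v).N] [BorelSpace ↥(cmBorelTriple L 3 v).N] (μ : Measure ↥(cmBorelTriple L 3 v).N) [μ.IsHaarMeasure]
    (fK : haveI := locallyCompactSpace_cmBorelU L 3 v
      Representation.SmoothInd (cmBorelTriple L 3 v).P (Representation.twist (((Representation.trivial ℂ ↥(torusU (conjLocal L (IsCMField.complexConj L) v) (cmLocalForm L 3 v)) ℂ).twist
        (cmTorusCharPair L v χ₁ χ₂)).comp (cmBorelTriple L 3 v).proj) (rootDeltaChar (cmBorelTriple L 3 v).P)))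
    (hfK : haveI := locallyCompactSpace_cmBorelU L 3 v
      fK ∈ (Representation.smoothIndRep (cmBorelTriple L 3 v).P _).fixedPoints (cmLocalIntegralLevel L 3 (Matrix.of fun i j : Fin 3 => if i.val + j.val + 1 = 3 then (1 : L) else 0) v))
    (fK' : haveI := locallyCompactSpace_cmBorelU L 3 v
      Representation.SmoothInd (cmBorelTriple L 3 v).P (Representation.twist (((Representation.trivial ℂ ↥(torusU (conjLocal L (IsCMField.complexConj L) v) (cmLocalForm L 3 v)) ℂ).twist
        (cmTorusCharPair L v (conjInvChar (conjLocal L (IsCMField.complexConj L) v) χ₁) χ₂)).comp (cmBorelTriple L 3 v).proj) (rootDeltaChar (cmBorelTriple L 3 v).P)))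
    (hfK' : haveI := locallyCompactSpace_cmBorelU L 3 v
      fK' ∈ (Representation.smoothIndRep (cmBorelTriple L 3 v).P _).fixedPoints (cmLocalIntegralLevel L 3 (Matrix.of fun i j : Fin 3 => if i.val + j.val + 1 = 3 then (1 : L) else 0) v))
    (h1 : fK'.toFun 1 = 1) :
    ∃ J : (cmPrincipalSeries L 3 v (cmTorusCharPair L v χ₁ χ₂)).IntertwiningMap (cmPrincipalSeries L 3 v (cmTorusCharPair L v (conjInvChar (conjLocal L (IsCMField.complexConj L) v) χ₁) χ₂)),
      J ≠ 0 ∧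
      (∀ (f : haveI := locallyCompactSpace_cmBorelU L 3 v
      Representation.SmoothInd (cmBorelTriple L 3 v).P (Representation.twist (((Representation.trivial ℂ ↥(torusU (conjLocal L (IsCMField.complexConj L) v) (cmLocalForm L 3 v)) ℂ).twist
        (cmTorusCharPair L v χ₁ χ₂)).comp (cmBorelTriple L 3 v).proj) (rootDeltaChar (cmBorelTriple L 3 v).P)))
        (g : ↥(unitaryGroupOfForm (conjLocal L (IsCMField.complexConj L) v) (cmLocalForm L 3 v))),
        (J f).toFun g = ∫ n : ↥(cmBorelTriple L 3 v).N, f.toFun (w₀ * (n : ↥(unitaryGroupOfForm (conjLocal L (IsCMField.complexConj L) v) (cmLocalForm L 3 v))) * g) ∂μ) ∧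
      J fK = ((μ.real {u : ↥(cmBorelTriple L 3 v).N | (((∏ w' : PlacesOver L v, normAbs (w'.1.adicCompletion L) ((((((u : ↥(unitaryGroupOfForm (conjLocal L (IsCMField.complexConj L) v) (cmLocalForm L 3 v)))) : GL (Fin 3) (LocalRing L v)) : Matrix (Fin 3) (Fin 3) (LocalRing L v)) 0 2) w')) : ℝ≥0) : ℝ) ≤ 1} : ℂ) * ((1 - ((χ₁ ϖ : ℂˣ) : ℂ) / ((Ideal.absNorm v.asIdeal : ℕ) : ℂ)) * (1 - ((χ₁ ϖ : ℂˣ) : ℂ))⁻¹) * fK.toFun 1) • fK' := by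
  obtain ⟨J, hJ, hJint, hJK⟩ := K2E3IntertwiningIntegralSphericalLine.exists_intertwiningIntegral_sphericalVector_eq_smul L v hns χ₁ χ₂ h₁ h₂ hs hχ₁ w₀ hw₀ μ
    fK hfK fK' hfK' h1
  refine ⟨J, hJ, hJint, ?_⟩
  rw [hJK, integral_cellFun_eq_macdonald_ramified L v hns w he χ₁ χ₂ h₂ hχ₂ hunr hs hχ₁ ϖ hϖ w₀ hw₀ μ fK hfK]

/-! ## §3 The organ's currency at a ramified place: `χ` trivial on `T ∩ K_v` and contracting -/

set_option synthInstance.maxHeartbeats 400000 in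
set_option maxHeartbeats 8000000 in
-- statement∕proof over two `SmoothInd` carriers of ★ `cmPrincipalSeries` (class of ★ `K2E3SphericalCFunctionOrganCurrency.exists_intertwiningIntegral_sphericalVector_eq_macdonald_smul_of_trivial`)
/-- **HARISH-CHANDRA'S `c`-FUNCTION OF A `K_v`-SPHERICAL CONTRACTING `i_G(χ₁, χ₂)` AT EVERY RAMIFIED PLACE, organ currency** (the ramified twin of ★ p856667 §3 ∕ ★ p856802 §4): `v` non-split,
`e(w|v) ≠ 1`, `χ = (χ₁, χ₂)` continuous, TRIVIAL ON `T ∩ K_v`, `χ₁` CONTRACTING; `f_K ∈ i(χ)^{K_v}`, `f'_K ∈ i(wχ)^{K_v}`, `f'_K(1) = 1`; then `J ≠ 0` with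
**`J f_K = (μ(B₁)·(1 − z∕q_F)(1 − z)⁻¹ · f_K(1)) • f'_K`** (working hypotheses (H1)(H2)(H3) ★ p856288, then §2).
[cite: Rogawski1990, §4.5 p. 45; §12.2 p. 173] [cite: Casselman1995, §6.4 pp. 62–64] [cite: Keys1984, §4; §7 Thm (2)] [cite: CartierCorvallis1979, §IV.1] -/
theorem exists_intertwiningIntegral_sphericalVector_eq_macdonald_ramified_smul_of_trivial (hns : ∀ w : PlacesOver L v, IsCMField.complexConj L • w.1 = w.1) (w : PlacesOver L v)
    (he : v.asIdeal.ramificationIdx' w.1.asIdeal ≠ 1)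
    (χ₁ : (LocalRing L v)ˣ →* ℂˣ) (χ₂ : ↥(normOneUnits (conjLocal L (IsCMField.complexConj L) v)) →* ℂˣ)
    (h₁ : Continuous fun x => ((χ₁ x : ℂˣ) : ℂ)) (h₂ : Continuous fun x => ((χ₂ x : ℂˣ) : ℂ))
    (hχK : ∀ t : ↥(torusU (conjLocal L (IsCMField.complexConj L) v) (cmLocalForm L 3 v)), (t : ↥(unitaryGroupOfForm (conjLocal L (IsCMField.complexConj L) v) (cmLocalForm L 3 v))) ∈ cmLocalIntegralLevel L 3 (Matrix.of fun i j : Fin 3 => if i.val + j.val + 1 = 3 then (1 : L) else 0) v → cmTorusCharPair L v χ₁ χ₂ t = 1)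
    (hcontr : ∀ x : (LocalRing L v)ˣ, unitModulusChar (LocalRing L v) x < 1 → ‖((χ₁ x : ℂˣ) : ℂ)‖ < 1)
    (ϖ : (LocalRing L v)ˣ) (hϖ : ∀ w : PlacesOver L v, Valued.v ((ϖ : LocalRing L v) w) = WithZero.exp (-1 : ℤ))
    (w₀ : ↥(unitaryGroupOfForm (conjLocal L (IsCMField.complexConj L) v) (cmLocalForm L 3 v))) (hw₀ : Units.val (w₀ : GL (Fin 3) (LocalRing L v)) = cmLocalForm L 3 v)
    [MeasurableSpace ↥(cmBorelTriple L 3 v).N] [BorelSpace ↥(cmBorelTriple L 3 v).N] (μ : Measure ↥(cmBorelTriple L 3 v).N) [μ.IsHaarMeasure]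
    (fK : haveI := locallyCompactSpace_cmBorelU L 3 v
      Representation.SmoothInd (cmBorelTriple L 3 v).P (Representation.twist (((Representation.trivial ℂ ↥(torusU (conjLocal L (IsCMField.complexConj L) v) (cmLocalForm L 3 v)) ℂ).twist
        (cmTorusCharPair L v χ₁ χ₂)).comp (cmBorelTriple L 3 v).proj) (rootDeltaChar (cmBorelTriple L 3 v).P)))
    (hfK : haveI := locallyCompactSpace_cmBorelU L 3 v
      fK ∈ (Representation.smoothIndRep (cmBorelTriple L 3 v).P _).fixedPoints (cmLocalIntegralLevel L 3 (Matrix.of fun i j : Fin 3 => if i.val + j.val + 1 = 3 then (1 : L) else 0) v))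
    (fK' : haveI := locallyCompactSpace_cmBorelU L 3 v
      Representation.SmoothInd (cmBorelTriple L 3 v).P (Representation.twist (((Representation.trivial ℂ ↥(torusU (conjLocal L (IsCMField.complexConj L) v) (cmLocalForm L 3 v)) ℂ).twist
        (cmTorusCharPair L v (conjInvChar (conjLocal L (IsCMField.complexConj L) v) χ₁) χ₂)).comp (cmBorelTriple L 3 v).proj) (rootDeltaChar (cmBorelTriple L 3 v).P)))
    (hfK' : haveI := locallyCompactSpace_cmBorelU L 3 v
      fK' ∈ (Representation.smoothIndRep (cmBorelTriple L 3 v).P _).fixedPoints (cmLocalIntegralLevel L 3 (Matrix.of fun i j : Fin 3 => if i.val + j.val + 1 = 3 then (1 : L) else 0) v))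
    (hK'1 : fK'.toFun 1 = 1) :
    ∃ J : (cmPrincipalSeries L 3 v (cmTorusCharPair L v χ₁ χ₂)).IntertwiningMap (cmPrincipalSeries L 3 v (cmTorusCharPair L v (conjInvChar (conjLocal L (IsCMField.complexConj L) v) χ₁) χ₂)),
      J ≠ 0 ∧
      (∀ (f : haveI := locallyCompactSpace_cmBorelU L 3 v
      Representation.SmoothInd (cmBorelTriple L 3 v).P (Representation.twist (((Representation.trivial ℂ ↥(torusU (conjLocal L (IsCMField.complexConj L) v) (cmLocalForm L 3 v)) ℂ).twist
        (cmTorusCharPair L v χ₁ χ₂)).comp (cmBorelTriple L 3 v).proj) (rootDeltaChar (cmBorelTriple L 3 v).P)))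
        (g : ↥(unitaryGroupOfForm (conjLocal L (IsCMField.complexConj L) v) (cmLocalForm L 3 v))),
        (J f).toFun g = ∫ n : ↥(cmBorelTriple L 3 v).N, f.toFun (w₀ * (n : ↥(unitaryGroupOfForm (conjLocal L (IsCMField.complexConj L) v) (cmLocalForm L 3 v))) * g) ∂μ) ∧
      J fK = ((μ.real {u : ↥(cmBorelTriple L 3 v).N | (((∏ w' : PlacesOver L v, normAbs (w'.1.adicCompletion L) ((((((u : ↥(unitaryGroupOfForm (conjLocal L (IsCMField.complexConj L) v) (cmLocalForm L 3 v)))) : GL (Fin 3) (LocalRing L v)) : Matrix (Fin 3) (Fin 3) (LocalRing L v)) 0 2) w')) : ℝ≥0) : ℝ) ≤ 1} : ℂ) * ((1 - ((χ₁ ϖ : ℂˣ) : ℂ) / ((Ideal.absNorm v.asIdeal : ℕ) : ℂ)) * (1 - ((χ₁ ϖ : ℂˣ) : ℂ))⁻¹) * fK.toFun 1) • fK' := by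
  have hunr := K2E3SphericalCFunctionUnramifiedHypotheses.apply_eq_one_of_mem_unitsIntegers_of_trivial L v hns χ₁ χ₂ hχK
  have hχ₂ := K2E3SphericalCFunctionUnramifiedHypotheses.apply_neg_one_eq_one_of_trivial L v hns χ₁ χ₂ hχK
  obtain ⟨s, hs, hχ₁⟩ := K2E3SphericalCFunctionUnramifiedHypotheses.exists_rpow_modulus_of_unramified_of_contracting L v hns χ₁ hunr hcontr
  exact exists_intertwiningIntegral_sphericalVector_eq_macdonald_ramified_smul L v hns w he χ₁ χ₂ h₁ h₂ hχ₂ hunr hs hχ₁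
    ϖ hϖ w₀ hw₀ μ fK hfK fK' hfK' hK'1

/-! ## §4 The junction at every ramified place: reducible ⟺ the counter-intertwiner kills the spherical vector -/

set_option synthInstance.maxHeartbeats 400000 in
set_option maxHeartbeats 8000000 in
-- statement∕proof over two `SmoothInd` carriers of ★ `cmPrincipalSeries` (class of ★ `K2E3SphericalReducibilityJunction.reducible_iff_forall_counterIntertwiner_eval_eq_zero_ramified`)
/-- **THE JUNCTION AT EVERY RAMIFIED PLACE, WILD INCLUDED** — ★ p856463 (ramified) without `|2|_w = 1`.  `v` non-split with `e(w|v) ≠ 1`, `w₀` of matrix `Φ₃`, `μ` Haar on `N(L⁺_v)`, `ϖ` a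
uniformiser unit; `χ₁, χ₂` continuous, `χ₂(−1) = 1`, `χ₁ = 1` on `𝒪_vˣ`, `|χ₁| = ‖·‖^s` with `s > 0` (so `χ` is regular and `|z| < 1`, `z = χ₁(ϖ)`); `f_K ∈ i(χ)^{K_v}`, `f'_K ∈ i(wχ)^{K_v}`
with `f_K(1) = f'_K(1) = 1`.  Then **`i_G(χ)` is reducible ⟺ `(B f'_K)(1) = 0` for every `G`-map `B : i(wχ) → i(χ)`** (`A = J(w, χ)` has `(J f_K)(1) = μ(B₁)·(1 − z∕q_F)∕(1 − z) ≠ 0`,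
§2, ★ `measureReal_heightBall_one_pos`, `|z| < 1`; then ★ `reducible_iff_forall_eval_mul_eval_eq_zero`). [cite: Casselman1995, Thm. 6.6.2 p. 66; §6.4] [cite: Keys1984, §7 Thm (2); §3]
[cite: Rogawski1990, §4.5 p. 45; §12.2 p. 173] -/
theorem reducible_iff_forall_counterIntertwiner_eval_eq_zero_ramified (hns : ∀ w : PlacesOver L v, IsCMField.complexConj L • w.1 = w.1) (w : PlacesOver L v)
    (he : v.asIdeal.ramificationIdx' w.1.asIdeal ≠ 1)
    (χ₁ : (LocalRing L v)ˣ →* ℂˣ) (χ₂ : ↥(normOneUnits (conjLocal L (IsCMField.complexConj L) v)) →* ℂˣ) (h₁ : Continuous fun x => ((χ₁ x : ℂˣ) : ℂ)) (h₂ : Continuous fun x => ((χ₂ x : ℂˣ) : ℂ)) (hχ₂ : χ₂ ⟨-1, F0P3cStCharTSBigCellFactorisation.neg_one_mem_normOneUnits (conjLocal L (IsCMField.complexConj L) v)⟩ = 1)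
    (hunr : ∀ u ∈ (Submonoid.pi Set.univ (fun w : PlacesOver L v => (w.1.adicCompletionIntegers L).toSubring.toSubmonoid)).units, χ₁ u = 1) {s : ℝ} (hs : 0 < s)
    (hχ₁ : ∀ x : (LocalRing L v)ˣ, ‖((χ₁ x : ℂˣ) : ℂ)‖ = ((unitModulusChar (LocalRing L v) x : ℝ≥0) : ℝ) ^ s)
    (ϖ : (LocalRing L v)ˣ) (hϖ : ∀ w : PlacesOver L v, Valued.v ((ϖ : LocalRing L v) w) = WithZero.exp (-1 : ℤ))
    (w₀ : ↥(unitaryGroupOfForm (conjLocal L (IsCMField.complexConj L) v) (cmLocalForm L 3 v))) (hw₀ : Units.val (w₀ : GL (Fin 3) (LocalRing L v)) = cmLocalForm L 3 v)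
    [MeasurableSpace ↥(cmBorelTriple L 3 v).N] [BorelSpace ↥(cmBorelTriple L 3 v).N] (μ : Measure ↥(cmBorelTriple L 3 v).N) [μ.IsHaarMeasure]
    (fK : haveI := locallyCompactSpace_cmBorelU L 3 v
      Representation.SmoothInd (cmBorelTriple L 3 v).P (Representation.twist (((Representation.trivial ℂ ↥(torusU (conjLocal L (IsCMField.complexConj L) v) (cmLocalForm L 3 v)) ℂ).twist
        (cmTorusCharPair L v χ₁ χ₂)).comp (cmBorelTriple L 3 v).proj) (rootDeltaChar (cmBorelTriple L 3 v).P)))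
    (hfK : haveI := locallyCompactSpace_cmBorelU L 3 v
      fK ∈ (Representation.smoothIndRep (cmBorelTriple L 3 v).P _).fixedPoints (cmLocalIntegralLevel L 3 (Matrix.of fun i j : Fin 3 => if i.val + j.val + 1 = 3 then (1 : L) else 0) v)) (hK1 : fK.toFun 1 = 1)
    (fK' : haveI := locallyCompactSpace_cmBorelU L 3 v
      Representation.SmoothInd (cmBorelTriple L 3 v).P (Representation.twist (((Representation.trivial ℂ ↥(torusU (conjLocal L (IsCMField.complexConj L) v) (cmLocalForm L 3 v)) ℂ).twist
        (cmTorusCharPair L v (conjInvChar (conjLocal L (IsCMField.complexConj L) v) χ₁) χ₂)).comp (cmBorelTriple L 3 v).proj) (rootDeltaChar (cmBorelTriple L 3 v).P)))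
    (hfK' : haveI := locallyCompactSpace_cmBorelU L 3 v
      fK' ∈ (Representation.smoothIndRep (cmBorelTriple L 3 v).P _).fixedPoints (cmLocalIntegralLevel L 3 (Matrix.of fun i j : Fin 3 => if i.val + j.val + 1 = 3 then (1 : L) else 0) v)) (hK'1 : fK'.toFun 1 = 1) :
    (∃ N : Subrepresentation (cmPrincipalSeries L 3 v (cmTorusCharPair L v χ₁ χ₂)), N ≠ ⊥ ∧ N ≠ ⊤) ↔
      ∀ (B : (cmPrincipalSeries L 3 v (cmTorusCharPair L v (conjInvChar (conjLocal L (IsCMField.complexConj L) v) χ₁) χ₂)).IntertwiningMap (cmPrincipalSeries L 3 v (cmTorusCharPair L v χ₁ χ₂))), (B fK').toFun 1 = 0 := by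
  have ha0 : 0 < ((unitModulusChar (LocalRing L v) ϖ : ℝ≥0) : ℝ) := NNReal.coe_pos.2 distribHaarChar_pos
  have ha1 : ((unitModulusChar (LocalRing L v) ϖ : ℝ≥0) : ℝ) < 1 := by exact_mod_cast K2E3SphericalCFunctionShellExpansion.unitModulusChar_uniformizer_lt_one L v hns ϖ hϖ
  have hz : ‖((χ₁ ϖ : ℂˣ) : ℂ)‖ < 1 := by rw [hχ₁ ϖ]; exact Real.rpow_lt_one ha0.le ha1 hs
  have hreg := K2E3NonUnitaryCharacterDichotomy.cmTorusCharPair_ne_weyl_of_exists_norm_ne_one L v hns χ₁ χ₂ h₁ ⟨ϖ, hz.ne⟩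
  -- the intertwining integral and its Macdonald value on `f_K`
  obtain ⟨J, -, -, hJK⟩ := exists_intertwiningIntegral_sphericalVector_eq_macdonald_ramified_smul L v hns w he χ₁ χ₂ h₁ h₂ hχ₂ hunr hs hχ₁
    ϖ hϖ w₀ hw₀ μ fK hfK fK' hfK' hK'1
  have hq1 : (1 : ℝ) ≤ ((Ideal.absNorm v.asIdeal : ℕ) : ℝ) := by exact_mod_cast Nat.one_le_iff_ne_zero.2 fun h => v.ne_bot (Ideal.absNorm_eq_zero_iff.1 h)
  have hq0 : ((Ideal.absNorm v.asIdeal : ℕ) : ℂ) ≠ 0 := by exact_mod_cast fun h => v.ne_bot (Ideal.absNorm_eq_zero_iff.1 h)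
  have hnq : ‖((Ideal.absNorm v.asIdeal : ℕ) : ℂ)‖ = ((Ideal.absNorm v.asIdeal : ℕ) : ℝ) := by rw [Complex.norm_natCast]
  -- `|z∕q| < 1`, `|z∕q²| < 1`, `|z²| < 1`, `|z| < 1` ⇒ the Macdonald factors are units
  have hsmall : ∀ t : ℂ, ‖t‖ < 1 → (1 + t ≠ 0 ∧ 1 - t ≠ 0) := fun t ht =>
    ⟨fun h => by rw [add_eq_zero_iff_eq_neg] at h; rw [← neg_neg t, ← h, norm_neg, norm_one] at ht; exact lt_irrefl _ ht,
     fun h => by rw [sub_eq_zero] at h; rw [← h, norm_one] at ht; exact lt_irrefl _ ht⟩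
  have hzq : ‖((χ₁ ϖ : ℂˣ) : ℂ) / ((Ideal.absNorm v.asIdeal : ℕ) : ℂ)‖ < 1 := by
    rw [norm_div, hnq]; exact (div_le_self (norm_nonneg _) hq1).trans_lt hz
  have hzq2 : ‖((χ₁ ϖ : ℂˣ) : ℂ) / ((Ideal.absNorm v.asIdeal : ℕ) : ℂ) ^ 2‖ < 1 := by
    rw [norm_div, norm_pow, hnq]; exact (div_le_self (norm_nonneg _) (one_le_pow₀ hq1)).trans_lt hz
  have hz2 : ‖((χ₁ ϖ : ℂˣ) : ℂ) ^ 2‖ < 1 := by rw [norm_pow]; exact pow_lt_one₀ (norm_nonneg _) hz two_ne_zero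
  have hM : (μ.real {u : ↥(cmBorelTriple L 3 v).N | (((∏ w' : PlacesOver L v, normAbs (w'.1.adicCompletion L) ((((((u : ↥(unitaryGroupOfForm (conjLocal L (IsCMField.complexConj L) v) (cmLocalForm L 3 v)))) : GL (Fin 3) (LocalRing L v)) : Matrix (Fin 3) (Fin 3) (LocalRing L v)) 0 2) w')) : ℝ≥0) : ℝ) ≤ 1} : ℂ) ≠ 0 := by exact_mod_cast (K2E3SphericalReducibilityJunction.measureReal_heightBall_one_pos L v hns ϖ hϖ μ).ne'
  have hc0 : (J fK).toFun 1 ≠ 0 := by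
    rw [hJK, Representation.SmoothInd.toFun_smul, Pi.smul_apply, hK'1, hK1, smul_eq_mul, mul_one, mul_one]
    exact mul_ne_zero hM (mul_ne_zero (hsmall _ hzq).2 (inv_ne_zero (hsmall _ hz).2))
  rw [K2E3SphericalReducibilityJunction.reducible_iff_forall_eval_mul_eval_eq_zero L v hns χ₁ χ₂ h₁ h₂ hreg fK hfK hK1 fK' hfK' hK'1]
  exact ⟨fun h B => (mul_eq_zero.1 (h J B)).resolve_left hc0, fun h A B => by rw [h B, mul_zero]⟩

end Summit.HodgeConjecture.HodgeConjecture.Cruxes.H413.K2E3SphericalCFunctionMacdonaldRamifiedWild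

end
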